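import Mathlib
import Literature.Barriers.ValiantsHypothesis.AlgebraicNaturalProofs
import Literature.Computability.AlgebraicComplexity.ApolarityAction
import Summits.ValiantsHypothesis.ValiantsHypothesis.Theorems.BarrierLeverSuccinctHittingSetsForVPStubSeparableCoeff
import Summits.ValiantsHypothesis.ValiantsHypothesis.Theorems.BarrierLeverSuccinctHittingSetsForVPStubRisingDiagonal
import Summits.ValiantsHypothesis.ValiantsHypothesis.Theorems.BarrierLeverSuccinctHittingSetsForVPStubPartialsIndependent
import HarnessLib

/-!
# Crux `BarrierLever.SuccinctHittingSetsForVP` (stmt-ValiantsHypothesis-14610), line `registered` —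
THE PARTIAL-DERIVATIVE MEASURE IS MAXIMAL ON SMALL CIRCUITS
(Nisan–Wigderson's rank method at full threshold is not a natural proof against `VP` in regime `d = n`)

**What is proved (unconditional; evidence for the open stub in the direction the crux predicts for
rank methods — cf. the route's Barriers note on `Literature.Barriers.ValiantsHypothesis.RankMethods`:
"flattening minors are `VP_N`-natural distinguishers, which crux 2 says cannot vanish on all small
circuits"; it does NOT close the item).**

* `exists_allOnes_mem_smallCircuits` : for `n ≥ 8` the ALL-ONES polynomial — the unique degree-`≤ n`
  polynomial with every coefficient `1`, i.e. `Σ_{|m| ≤ n} x^m`, the truncation of `∏_i 1/(1 - x_i)` —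
  lies in `SmallCircuits ℂ n 8` (landed `stub_separableCoeff`, p153631, with `c ≡ 1`).
* `stub_partialsMaximal` / `partialDerivatives_linearIndependent` : its order-`k` partial derivatives
  `∂^u f = x^u ⌟ f`, `|u| = k`, are LINEARLY INDEPENDENT for every `k ≤ n/2` (wave 5:
  `stub_partialsIndependent` p158066 fed by the finite-difference identity `stub_risingDiagonal`
  p158170: the `v`-th iterated difference of `w ↦ ∏_i (w_i+u_i)!/w_i!` at `0` is diagonal on the
  slice `|u| = |v|`). Hence the dimension of the space of order-`k` partials — Nisan–Wigderson's
  measure, the rank of the partial-derivative flattening `P_k[u, w] = coeff_w(∂^u f)` — attains on a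
  member of `SmallCircuits ℂ n 8` its GENERIC MAXIMUM, the number `C(n+k-1, k)` of order-`k`
  operators (`finrank_span_partialDerivatives`). A lower-bound proof "rank `P_k(f) < C(n+k-1,k)` for
  all `f ∈ VP_n(n^b)`", `b ≥ 8`, is therefore impossible: in the regime `d = n` the partial-derivative
  method is useless against `VP` not because of a conditional barrier but by an explicit small circuit.

Not covered (recorded for refuters): the plain catalecticant `M_k[u, w] = coeff_{u+w} f` (no
multiplicities) is the all-ones matrix at this `f`; whether small circuits reach full catalecticant
rank is the cleanest open sub-question of `stub_superDense` (lead report c3, §Analysis).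
Axioms: `propext`, `Classical.choice`, `Quot.sound`. References: Nisan–Wigderson 1996 (the measure);
[ForbesShpilkaVolk2018] §1.2 (rank methods are algebraically natural), Question 6.
-/

-- layout Summits/ValiantsHypothesis/ValiantsHypothesis forces the duplicated namespace component
set_option linter.dupNamespace false

namespace Summit.ValiantsHypothesis.ValiantsHypothesis.Theorems.BarrierLever.SuccinctHittingSetsForVP

open Literature.Barriers.ValiantsHypothesis Literature.Computability.AlgebraicComplexity MvPolynomial

/-- **The all-ones polynomial is a small circuit.** For `n ≥ 8` some `f ∈ SmallCircuits ℂ n 8` has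
`coeff_m f = 1` for every `m` of degree `≤ n` (so `f = Σ_{|m| ≤ n} x^m`, `deg f ≤ n`).
[cite: ForbesShpilkaVolk2018, Construction 25] -/
theorem exists_allOnes_mem_smallCircuits (n : ℕ) (hn : 8 ≤ n) :
    ∃ f ∈ SmallCircuits ℂ n 8, ∀ m : Fin n →₀ ℕ, m.degree ≤ n → coeff m f = 1 := by
  obtain ⟨Λ, hΛ, hcoeff⟩ := stub_separableCoeff n hn (fun _ _ => 1)
  refine ⟨Λ, hΛ, fun m hm => ?_⟩
  have h := hcoeff ⟨m, hm⟩
  rw [Finset.prod_const_one] at h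
  exact h

/-- **Registered stub `stub_partialsMaximal`** (crux stmt-ValiantsHypothesis-14610, line
`registered`; wave 5 assembled): for `n ≥ 8` some `f ∈ SmallCircuits ℂ n 8` has linearly independent
order-`k` partial derivatives `x^u ⌟ f`, `|u| = k`, for every `k ≤ n/2`. [folklore] -/
theorem stub_partialsMaximal :
    ∀ n : ℕ, 8 ≤ n → ∃ f ∈ SmallCircuits ℂ n 8, ∀ k : ℕ, 2 * k ≤ n →
      LinearIndependent ℂ
        (fun u : {u : Fin n →₀ ℕ // u.degree = k} => apolarAction (monomial u.1 (1 : ℂ)) f) := by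
  intro n hn
  obtain ⟨f, hf, hcoef⟩ := exists_allOnes_mem_smallCircuits n hn
  exact ⟨f, hf, fun k hk => stub_partialsIndependent stub_risingDiagonal n k f hk hcoef⟩

/-- **The partial-derivative measure is maximal on small circuits** (unconditional form of the
registered stub): verbatim `stub_partialsMaximal`. [folklore] -/
theorem partialDerivatives_linearIndependent (n : ℕ) (hn : 8 ≤ n) :
    ∃ f ∈ SmallCircuits ℂ n 8, ∀ k : ℕ, 2 * k ≤ n →
      LinearIndependent ℂ
        (fun u : {u : Fin n →₀ ℕ // u.degree = k} => apolarAction (monomial u.1 (1 : ℂ)) f) :=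
  stub_partialsMaximal n hn

/-- The order-`k` operators form a finite type. [folklore] -/
theorem finite_degree_eq (n k : ℕ) : Finite {u : Fin n →₀ ℕ // u.degree = k} :=
  Set.Finite.to_subtype ((Finsupp.finite_of_degree_le (σ := Fin n) k).subset fun _ hu => le_of_eq hu)

/-- **Rank form**: the span of the order-`k` partial derivatives of that `f` has dimension equal to
the number of order-`k` operators (`= C(n+k-1, k)`, the generic maximum of Nisan–Wigderson's
measure), for every `k ≤ n/2`. [folklore] -/
theorem finrank_span_partialDerivatives (n : ℕ) (hn : 8 ≤ n) :
    ∃ f ∈ SmallCircuits ℂ n 8, ∀ k : ℕ, 2 * k ≤ n →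
      Module.finrank ℂ (Submodule.span ℂ (Set.range
        (fun u : {u : Fin n →₀ ℕ // u.degree = k} => apolarAction (monomial u.1 (1 : ℂ)) f))) =
        Nat.card {u : Fin n →₀ ℕ // u.degree = k} := by
  obtain ⟨f, hf, hli⟩ := partialDerivatives_linearIndependent n hn
  refine ⟨f, hf, fun k hk => ?_⟩
  haveI := finite_degree_eq n k
  haveI : Fintype {u : Fin n →₀ ℕ // u.degree = k} := Fintype.ofFinite _
  rw [finrank_span_eq_card (hli k hk), Nat.card_eq_fintype_card]

end Summit.ValiantsHypothesis.ValiantsHypothesis.Theorems.BarrierLever.SuccinctHittingSetsForVP
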